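import Summits.HodgeConjecture.HodgeConjecture.Theorems.MilnorKExponentialSymbolLiftRPowerNormalisationForms
import HarnessLib

/-!
# Power normalisation (S2 of line `lefschetz-fold`, crux `SymbolLiftR`), II: the zig-zag

Helper file for `stub_powerNormalisation` (route `MilnorKExponential` of the Hodge summit, item
stmt-HodgeConjecture-18702), all proved. The EXPLICIT Čech–de Rham staircase (Bott–Tu (1982), §8,
proof of Prop. 8.8) of the symbol forms of the cup powers `L.symbolCochain q` of the transition
cocycle of a holomorphic line cocycle `L`, for `1`-forms `α_i` smooth on `U_i` with `dα_i = T` and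
`dlog g_{ij} = α_i - α_j`: `Z_{a,2q+1-a} = ε_a (P_a ∪ α) ∧ T^{q-a}` restricted to `U_K`
(`ε_a = (-1)^{q+1+q(q+1)/2+a(a+1)/2}`), with top `δ Z_{q,q+1} = dlog g ∧ ⋯ ∧ dlog g` (telescoping),
steps `cechd Z_{a+1,b} = δ Z_{a,b+1}` and bottom `d Z_{0,2q+1} = ε_0 T^{q+1}`:
`isTransgression_symbolCochain`. Preceded by the algebra of powers of a `2`-form
(`(Q ∧ T) ∧ T^m = Q ∧ T^{m+1}` up to degree casts) and the three key identities of forms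
(`top_key`, `step_key`, `bottom_key`).
-/

noncomputable section
open scoped Manifold ContDiff Topology

-- `Summit.HodgeConjecture.HodgeConjecture.Theorems` is the mandated namespace (single-conjunct summit:
-- Sub = Summit), which `linter.dupNamespace` flags on every declaration; the lakefile turns the
-- linter off tree-wide (weak option), restated here so stand-alone elaboration is warning-free too.
set_option linter.dupNamespace false

namespace Summit.HodgeConjecture.HodgeConjecture.Theorems.SymbolLiftR
open Literature.AlgebraicGeometry Literature.AlgebraicGeometry.HodgeTheory
open Literature.Geometry.Kaehler Literature.NumberTheory.Transcendental

namespace PowerNormalisation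

open Set Filter

/-! ### Part 3. Algebra of the staircase: powers of a `2`-form, signs, the three key identities -/

section Keys

variable {E : Type*} [NormedAddCommGroup E] [NormedSpace ℝ E]
  {H : Type*} [TopologicalSpace H] {I : ModelWithCorners ℝ E H}
  {M : Type*} [TopologicalSpace M] [ChartedSpace H M]
  {A : Type*} [NormedCommRing A] [NormedAlgebra ℝ A]

/-- `1 ∧ β = β` up to the cast `l = 0 + l`. [folklore] -/
theorem ofFun_one_wedge {l : ℕ} (β : MForm I M A l) :
    (MForm.ofFun I fun _ : M ↦ (1 : A)).wedge β = β.castDeg (Nat.zero_add l).symm := by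
  rw [MForm.ofFun_wedge]
  congr 1
  funext x
  exact one_smul A (β x)

/-- `β ∧ 1 = β`. [folklore] -/
theorem wedge_ofFun_one {k : ℕ} (β : MForm I M A k) :
    β.wedge (MForm.ofFun I fun _ : M ↦ (1 : A)) = β := by
  rw [MForm.wedge_ofFun]
  funext x
  exact one_smul A (β x)

/-- Powers along equal exponents agree up to the cast. [folklore] -/
theorem twoFormPow_congr (T : MForm I M A 2) {m m' : ℕ} (h : m = m') :
    MForm.twoFormPow I M T m = (MForm.twoFormPow I M T m').castDeg (by rw [h]) := by
  subst h
  rfl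

/-- `β ∧ T^n = β` for `n = 0`, up to the cast. [folklore] -/
theorem wedge_twoFormPow_of_eq_zero {k : ℕ} (β : MForm I M A k) (T : MForm I M A 2) {n : ℕ}
    (hn : n = 0) : β.wedge (MForm.twoFormPow I M T n) = β.castDeg (by omega) := by
  subst hn
  rw [MForm.twoFormPow_zero, MForm.wedge_castDeg]
  have h : β.wedge (MForm.const I M (1 : A)) = β := wedge_ofFun_one β
  rw [h]

/-- `∑ (-1)^j (s Fⱼ ∧ T').castDeg = (s (∑ (-1)^j Fⱼ) ∧ T').castDeg`. [folklore] -/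
theorem sum_sign_smul_castDeg {a k l b : ℕ} (s : ℝ) (F : Fin (a + 2) → MForm I M A k) (T' : MForm I M A l)
    (e : k + l = b) :
    ∑ j : Fin (a + 2), (-1 : ℝ) ^ (j : ℕ) • ((s • (F j).wedge T').castDeg e) =
      s • (((∑ j : Fin (a + 2), (-1 : ℝ) ^ (j : ℕ) • F j).wedge T').castDeg e) := by
  have h : ∀ j : Fin (a + 2), (-1 : ℝ) ^ (j : ℕ) • ((s • (F j).wedge T').castDeg e) =
      s • (((-1 : ℝ) ^ (j : ℕ) • (F j).wedge T').castDeg e) := fun j ↦ by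
    rw [MForm.castDeg_smul, MForm.castDeg_smul, smul_comm]
  rw [Finset.sum_congr rfl fun j _ ↦ h j, ← Finset.smul_sum, ← MForm.castDeg_sum, ← sum_smul_wedge]

/-- `ε_{a+1} = (-1)^{a+1} ε_a` for the exponents `sgn(a) = q + 1 + q(q+1)/2 + a(a+1)/2`. [folklore] -/
theorem sgnExp_succ (q a : ℕ) :
    q + 1 + q * (q + 1) / 2 + (a + 1) * (a + 1 + 1) / 2 = q + 1 + q * (q + 1) / 2 + a * (a + 1) / 2 + (a + 1) := by
  have h : (a + 1) * (a + 1 + 1) = a * (a + 1) + 2 * (a + 1) := by ring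
  rw [h, Nat.add_mul_div_left _ _ two_pos]
  ring

/-- `ε_q = (-1)^{q+1}`. [folklore] -/
theorem neg_one_pow_sgnExp_self (q : ℕ) :
    (-1 : ℝ) ^ (q + 1 + q * (q + 1) / 2 + q * (q + 1) / 2) = (-1) ^ (q + 1) := by
  rw [add_assoc, ← two_mul, pow_add, pow_mul, neg_one_sq, one_pow, mul_one]

variable [WedgeFacts I M A]

/-- `T ∧ T^m = T^{m+1}` up to the cast (`2`-forms commute with everything). [folklore] -/
theorem twoForm_wedge_twoFormPow (T : MForm I M A 2) (m : ℕ) :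
    T.wedge (MForm.twoFormPow I M T m) =
      (MForm.twoFormPow I M T (m + 1)).castDeg (by ring : 2 * (m + 1) = 2 + 2 * m) := by
  have h1 : ((-1 : ℝ) ^ (2 * m * 2)) = 1 := by
    rw [show 2 * m * 2 = 2 * (m * 2) by ring, pow_mul, neg_one_sq, one_pow]
  rw [MForm.wedge_comm (MForm.twoFormPow I M T m) T, h1, one_smul, MForm.twoFormPow_succ,
    MForm.castDeg_castDeg]

/-- `(Q ∧ T) ∧ T^m = Q ∧ T^{m+1}` up to the cast. [folklore] -/
theorem wedge_wedge_twoFormPow {k : ℕ} (Q : MForm I M A k) (T : MForm I M A 2) (m : ℕ) :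
    (Q.wedge T).wedge (MForm.twoFormPow I M T m) =
      (Q.wedge (MForm.twoFormPow I M T (m + 1))).castDeg (by ring : k + 2 * (m + 1) = k + 2 + 2 * m) := by
  rw [MForm.wedge_assoc, twoForm_wedge_twoFormPow, MForm.wedge_castDeg, MForm.castDeg_castDeg]

omit [WedgeFacts I M A] in
/-- **Top key**: `ε_q ((-1)^{q+1} P) ∧ T⁰ = P`. [folklore] -/
theorem top_key (q : ℕ) (P : MForm I M A (q + 1)) (T : MForm I M A 2) (e : q + 1 + 2 * (q - q) = q + 1) :
    (-1 : ℝ) ^ (q + 1 + q * (q + 1) / 2 + q * (q + 1) / 2) •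
        ((((-1 : ℝ) ^ (q + 1) • P).wedge (MForm.twoFormPow I M T (q - q))).castDeg e) = P := by
  rw [MForm.wedge_smul_left, wedge_twoFormPow_of_eq_zero _ _ (Nat.sub_self q)]
  simp only [MForm.castDeg_smul, MForm.castDeg_castDeg, smul_smul]
  rw [MForm.castDeg_eq_self, neg_one_pow_sgnExp_self, ← pow_add, ← two_mul, pow_mul, neg_one_sq, one_pow,
    one_smul]

/-- **Step key**: `(-1)^{a+1} ε_{a+1} (-1)^{a+1} (P ∧ T) ∧ T^{q-a-1} = ε_a ((-1)^{a+1} P) ∧ T^{q-a}`.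
[folklore] -/
theorem step_key (q a : ℕ) (_ha : a < q) (P : MForm I M A (a + 1)) (T : MForm I M A 2) {b : ℕ}
    (e₁ : a + 1 + 2 + 2 * (q - (a + 1)) = b + 1) (e₂ : a + 1 + 2 * (q - a) = b + 1) :
    (-1 : ℝ) ^ (a + 1) • ((-1 : ℝ) ^ (q + 1 + q * (q + 1) / 2 + (a + 1) * (a + 1 + 1) / 2) •
        (((-1 : ℝ) ^ (a + 1) • (P.wedge T).wedge (MForm.twoFormPow I M T (q - (a + 1)))).castDeg e₁)) =
      (-1 : ℝ) ^ (q + 1 + q * (q + 1) / 2 + a * (a + 1) / 2) •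
        ((((-1 : ℝ) ^ (a + 1) • P).wedge (MForm.twoFormPow I M T (q - a))).castDeg e₂) := by
  rw [MForm.wedge_smul_left, twoFormPow_congr T (show q - a = q - (a + 1) + 1 by omega), MForm.wedge_castDeg,
    wedge_wedge_twoFormPow]
  simp only [MForm.castDeg_smul, MForm.castDeg_castDeg, smul_smul]
  rw [sgnExp_succ, pow_add]
  have hu : (-1 : ℝ) ^ (a + 1) * (-1) ^ (a + 1) = 1 := by
    rw [← pow_add, ← two_mul, pow_mul, neg_one_sq, one_pow]
  congr 1
  linear_combination ((-1 : ℝ) ^ (q + 1 + q * (q + 1) / 2 + a * (a + 1) / 2) * (-1) ^ (a + 1)) * hu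

/-- **Bottom key**: `s ((1 ∧ T) ∧ T^q) = s T^{q+1}`. [folklore] -/
theorem bottom_key (q : ℕ) (T : MForm I M A 2) (e₁ : 0 + 2 + 2 * (q - 0) = 2 * q + 1 + 1)
    (hd : 2 * (q + 1) = 2 * q + 1 + 1) (s : ℝ) :
    s • (((-1 : ℝ) ^ 0 • ((MForm.ofFun I fun _ : M ↦ (1 : A)).wedge T).wedge
        (MForm.twoFormPow I M T (q - 0))).castDeg e₁) =
      (s • MForm.twoFormPow I M T (q + 1)).castDeg hd := by
  rw [pow_zero, one_smul, ofFun_one_wedge, MForm.castDeg_wedge, twoForm_wedge_twoFormPow,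
    MForm.castDeg_castDeg, MForm.castDeg_castDeg, MForm.castDeg_smul]
  rfl

end Keys

/-! ### Part 4. The explicit zig-zag (Bott–Tu (1982), §8, proof of Prop. 8.8) -/

section ZigZag

variable {E : Type*} [NormedAddCommGroup E] [NormedSpace ℂ E]
  {M : Type*} [TopologicalSpace M] [ChartedSpace E M] {ι : Type*}

/-- The restriction to an open set `U` of a form smooth at the points of `U` is a form on `U`.
[folklore] -/
theorem restr_mem_smoothFormsOn_of_smoothAt {k : ℕ} {U : Set M} (hU : IsOpen U)
    {β : MForm 𝓘(ℝ, E) M ℂ k} (h : ∀ x ∈ U, β.SmoothAt x) : β.restr U ∈ smoothFormsOn 𝓘(ℝ, E) ℂ U k :=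
  ⟨fun x hx ↦ (MForm.smoothAt_restr_iff hU β hx).2 (h x hx), fun _ hx ↦ MForm.restr_apply_of_notMem β hx⟩

/-- The degree of `Z_{a,b}`: `b = a + 1 + 2(q - a)` on the staircase. [folklore] -/
theorem zig_deg {q a b : ℕ} (hab : a ≤ q ∧ a + b = 2 * q + 1) : a + 1 + 2 * (q - a) = b := by
  omega

variable [IsManifold 𝓘(ℝ, E) ∞ M] [WedgeFacts 𝓘(ℝ, E) M ℂ]
  {L : HolomorphicLineBundle ι E M} {α : ι → MForm 𝓘(ℝ, E) M ℂ 1} {T : MForm 𝓘(ℝ, E) M ℂ 2}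

/-- **The explicit zig-zag.** On a complex manifold let `L` be a holomorphic line cocycle, `α_i`
`1`-forms smooth on `U_i` with `dα_i = T` there for a closed smooth global `2`-form `T`, and
`dlog g_{ij} = α_i - α_j` on `U_i ∩ U_j`. Then the symbol forms
`dlog g_{J₀J₁} ∧ ⋯ ∧ dlog g_{J_qJ_{q+1}}` of the cup powers `L.symbolCochain q` transgress through the
cochains `Z_{a,2q+1-a} = ε_a (P_a ∪ α) ∧ T^{q-a}|_{U_K}` (`ε_a = (-1)^{q+1+q(q+1)/2+a(a+1)/2}`) to
the global closed form `ε_0 T^{q+1}`: top by telescoping (`dlogWedge_telescope_apply`), steps by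
`d((P ∪ α) ∧ T^m) = ± (P ∧ T) ∧ T^m` (`mextDeriv_stair`) and telescoping, bottom by
`d(α ∧ T^q) = T^{q+1}`. [cite: BottTu1982Forms, §8 Prop. 8.8] [cite: VoisinHodgeI2002, Thm. 7.10 (proof)] -/
theorem isTransgression_symbolCochain (hαs : ∀ i, ∀ x ∈ L.baseSet i, (α i).SmoothAt x)
    (hdα : ∀ i, ∀ x ∈ L.baseSet i, mextDeriv (α i) x = T x)
    (hlink : ∀ a b, ∀ x ∈ L.baseSet a ∩ L.baseSet b, dlog E (L.coordChange a b) x = (α a - α b) x)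
    (hT : T ∈ closedSmoothForms 𝓘(ℝ, E) M ℂ 2) (q : ℕ) (hd : 2 * (q + 1) = 2 * q + 1 + 1) :
    IsTransgression L.isOpen_baseSet q (fun J ↦ symbolForm E (q + 1) (L.symbolCochain q J))
      (((-1 : ℝ) ^ (q + 1 + q * (q + 1) / 2 + 0 * (0 + 1) / 2) • MForm.twoFormPow 𝓘(ℝ, E) M T (q + 1)).castDeg hd) := by
  -- the zig-zag cochains
  set Z : (a b : ℕ) → CechForms 𝓘(ℝ, E) ℂ L.baseSet a b := fun a b K ↦
    if hab : a ≤ q ∧ a + b = 2 * q + 1 then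
      ⟨(((-1 : ℝ) ^ (q + 1 + q * (q + 1) / 2 + a * (a + 1) / 2) •
          (((dlogWedge E a fun i : Fin a ↦ L.coordChange (K (Fin.castSucc i)) (K i.succ)).wedge
            (α (K (Fin.last a)))).wedge (MForm.twoFormPow 𝓘(ℝ, E) M T (q - a)))).castDeg
              (zig_deg hab)).restr (cechSet L.baseSet K),
        restr_mem_smoothFormsOn_of_smoothAt (isOpen_cechSet L.isOpen_baseSet K) fun _ hx ↦
          ((smoothAt_stair hαs hdα hlink hT a (q - a) K hx).smul _).castDeg _⟩
    else 0 with hZ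
  -- their values and derivatives at the points of `U_K`, on the staircase
  have hZval : ∀ {a b : ℕ} (hab : a ≤ q ∧ a + b = 2 * q + 1) (K : Fin (a + 1) → ι) {x : M},
      x ∈ cechSet L.baseSet K →
        (Z a b K : MForm 𝓘(ℝ, E) M ℂ b) x = (((-1 : ℝ) ^ (q + 1 + q * (q + 1) / 2 + a * (a + 1) / 2) •
          (((dlogWedge E a fun i : Fin a ↦ L.coordChange (K (Fin.castSucc i)) (K i.succ)).wedge
            (α (K (Fin.last a)))).wedge (MForm.twoFormPow 𝓘(ℝ, E) M T (q - a)))).castDeg (zig_deg hab)) x ∧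
        mextDeriv (Z a b K : MForm 𝓘(ℝ, E) M ℂ b) x =
          mextDeriv ((((-1 : ℝ) ^ (q + 1 + q * (q + 1) / 2 + a * (a + 1) / 2) •
            (((dlogWedge E a fun i : Fin a ↦ L.coordChange (K (Fin.castSucc i)) (K i.succ)).wedge
              (α (K (Fin.last a)))).wedge (MForm.twoFormPow 𝓘(ℝ, E) M T (q - a)))).castDeg (zig_deg hab))) x := by
    intro a b hab K x hx
    rw [hZ]
    dsimp only
    rw [dif_pos hab]
    exact ⟨MForm.restr_apply_of_mem _ hx, mextDeriv_restr_apply (isOpen_cechSet L.isOpen_baseSet K) _ hx⟩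
  refine ⟨Z, fun J x hx ↦ ?_, fun a b hab ha ↦ ?_, fun K x hx ↦ ?_⟩
  · -- top
    have hq : q ≤ q ∧ q + (q + 1) = 2 * q + 1 := ⟨le_rfl, by ring⟩
    beta_reduce
    rw [coe_cechδ_apply_apply_of_mem L.isOpen_baseSet _ hx,
      Finset.sum_congr rfl fun j _ ↦ by
        rw [(hZval hq (J ∘ Fin.succAbove j) (cechSet_subset_comp _ J _ hx)).1],
      symbolForm_symbolCochain]
    have key : (∑ j : Fin (q + 2), (-1 : ℝ) ^ (j : ℕ) •
        (((-1 : ℝ) ^ (q + 1 + q * (q + 1) / 2 + q * (q + 1) / 2) •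
          (((dlogWedge E q fun i : Fin q ↦
              L.coordChange ((J ∘ Fin.succAbove j) (Fin.castSucc i)) ((J ∘ Fin.succAbove j) i.succ)).wedge
            (α ((J ∘ Fin.succAbove j) (Fin.last q)))).wedge (MForm.twoFormPow 𝓘(ℝ, E) M T (q - q)))).castDeg
              (zig_deg hq))) x =
        (dlogWedge E (q + 1) fun i : Fin (q + 1) ↦ L.coordChange (J (Fin.castSucc i)) (J i.succ)) x := by
      rw [sum_sign_smul_castDeg, Pi.smul_apply,
        MForm.castDeg_apply_eq _ (wedge_apply_congr_left _ (dlogWedge_telescope_apply hlink q J hx))]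
      exact congrFun (top_key q _ T (zig_deg hq)) x
    rw [Finset.sum_apply] at key
    exact key
  · -- steps
    funext K
    apply Subtype.ext
    funext x
    by_cases hx : x ∈ cechSet L.baseSet K
    · have h1 : a + 1 ≤ q ∧ a + 1 + b = 2 * q + 1 := ⟨ha, hab⟩
      have h2 : a ≤ q ∧ a + (b + 1) = 2 * q + 1 := ⟨ha.le, by omega⟩
      rw [cechd_apply, Submodule.coe_smul, Pi.smul_apply, localD_apply_of_mem _ _ hx, (hZval h1 K hx).2,
        mextDeriv_castDeg, mextDeriv_smul, MForm.castDeg_smul, Pi.smul_apply,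
        MForm.castDeg_apply_eq _ (mextDeriv_stair hαs hdα hlink hT (a + 1) (q - (a + 1)) K hx),
        MForm.castDeg_castDeg, coe_cechδ_apply_apply_of_mem L.isOpen_baseSet _ hx,
        Finset.sum_congr rfl fun j _ ↦ by
          rw [(hZval h2 (K ∘ Fin.succAbove j) (cechSet_subset_comp _ K _ hx)).1]]
      have key : (∑ j : Fin (a + 2), (-1 : ℝ) ^ (j : ℕ) •
          (((-1 : ℝ) ^ (q + 1 + q * (q + 1) / 2 + a * (a + 1) / 2) •
            (((dlogWedge E a fun i : Fin a ↦
                L.coordChange ((K ∘ Fin.succAbove j) (Fin.castSucc i)) ((K ∘ Fin.succAbove j) i.succ)).wedge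
              (α ((K ∘ Fin.succAbove j) (Fin.last a)))).wedge (MForm.twoFormPow 𝓘(ℝ, E) M T (q - a)))).castDeg
                (zig_deg h2))) x =
          ((-1 : ℝ) ^ (a + 1) • ((-1 : ℝ) ^ (q + 1 + q * (q + 1) / 2 + (a + 1) * (a + 1 + 1) / 2) •
            (((-1 : ℝ) ^ (a + 1) • ((dlogWedge E (a + 1) fun i : Fin (a + 1) ↦
                L.coordChange (K (Fin.castSucc i)) (K i.succ)).wedge T).wedge
              (MForm.twoFormPow 𝓘(ℝ, E) M T (q - (a + 1)))).castDeg (by omega)))) x := by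
        rw [sum_sign_smul_castDeg, Pi.smul_apply,
          MForm.castDeg_apply_eq _ (wedge_apply_congr_left _ (dlogWedge_telescope_apply hlink a K hx))]
        exact (congrFun (step_key q a ha _ T (by omega) (zig_deg h2)) x).symm
      rw [Finset.sum_apply] at key
      exact key.symm
    · rw [(cechd 𝓘(ℝ, E) ℂ L.isOpen_baseSet (a + 1) b (Z (a + 1) b) K).2.2 x hx,
        (cechδ 𝓘(ℝ, E) ℂ L.isOpen_baseSet a (b + 1) (Z a (b + 1)) K).2.2 x hx]
  · -- bottom
    have h0 : 0 ≤ q ∧ 0 + (2 * q + 1) = 2 * q + 1 := ⟨Nat.zero_le _, Nat.zero_add _⟩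
    rw [cechd_apply, pow_zero, one_smul, localD_apply_of_mem _ _ hx, (hZval h0 K hx).2, mextDeriv_castDeg,
      mextDeriv_smul, MForm.castDeg_smul, Pi.smul_apply,
      MForm.castDeg_apply_eq _ (mextDeriv_stair hαs hdα hlink hT 0 (q - 0) K hx), MForm.castDeg_castDeg,
      dlogWedge_zero]
    exact congrFun (bottom_key q T (by omega) hd _) x

end ZigZag

/-- **Registered sub-goal of S2 (`stub_powerNormalisation`), part II — the explicit zig-zag**
(`isTransgression_symbolCochain` with all data explicit): the symbol forms of the cup powers
`L.symbolCochain q` transgress to `ε_0 T^{q+1}` whenever `α_i` is smooth on `U_i` with `dα_i = T`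
there, `T` is closed smooth and `dlog g_{ij} = α_i - α_j` on `U_i ∩ U_j`.
[cite: BottTu1982Forms, §8 Prop. 8.8] -/
theorem stub_powerNormalisation_zigzag : ∀ {E : Type} [NormedAddCommGroup E] [NormedSpace ℂ E] {M : Type} [TopologicalSpace M] [ChartedSpace E M] [IsManifold 𝓘(ℝ, E) ∞ M] [WedgeFacts 𝓘(ℝ, E) M ℂ] {ι : Type} (L : HolomorphicLineBundle ι E M) (α : ι → MForm 𝓘(ℝ, E) M ℂ 1) (T : MForm 𝓘(ℝ, E) M ℂ 2), (∀ i, ∀ x ∈ L.baseSet i, (α i).SmoothAt x) → (∀ i, ∀ x ∈ L.baseSet i, mextDeriv (α i) x = T x) → (∀ a b, ∀ x ∈ L.baseSet a ∩ L.baseSet b, dlog E (L.coordChange a b) x = (α a - α b) x) → T ∈ closedSmoothForms 𝓘(ℝ, E) M ℂ 2 → ∀ (q : ℕ) (hd : 2 * (q + 1) = 2 * q + 1 + 1), IsTransgression L.isOpen_baseSet q (fun J ↦ symbolForm E (q + 1) (L.symbolCochain q J)) (((-1 : ℝ) ^ (q + 1 + q * (q + 1) / 2 + 0 * (0 + 1)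 / 2) • MForm.twoFormPow 𝓘(ℝ, E) M T (q + 1)).castDeg hd) :=
  fun L _ _ hαs hdα hlink hT q hd ↦ isTransgression_symbolCochain (L := L) hαs hdα hlink hT q hd

end PowerNormalisation

end Summit.HodgeConjecture.HodgeConjecture.Theorems.SymbolLiftR

end
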